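import Literature.MeasureTheory.Group.UnimodularOfCocompact     -- ★ `map_mul_right_eq_modularCharacter_smul`, `monoidHom_eq_one_of_bddBelow`
import Mathlib.MeasureTheory.Integral.Prod
import HarnessLib

/-!
# A left Haar measure is right-invariant under every compact subgroup; averaging over a compact subgroup
(Folland (1995), Prop. 2.27 ∕ Cor. 2.28; Bourbaki, *Intégration* VII §1 no. 3; Helgason (2000), Ch. I §1)

Topic `MeasureTheory/Group`; namespace `Literature.MeasureTheory.Group`.  THEOREMS ONLY (no definition, no named fact, no instance, no notation,
no `sorry`).  Cell `pub/hodgecm-mathlib`, F0∕P3a, seat F0P3a-p05 (g13), ROAD A of crux H413 (`stmt-HodgeConjecture-24833`), road (β) toward (A6): the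
measure-theoretic half of «the orbital integral of a regular element of `U(2,1)` as a two-level integral» — the `K`-average over the (compact) stabiliser
of the base point, for a group NOT known to be unimodular in the tree.  Count-neutral generic brick.

THE MATHEMATICS.  Let `G` be a second countable locally compact group with left Haar measure `ν` and modular function `Δ`
(`(· g)_* ν = Δ(g) • ν`, ★ `map_mul_right_eq_modularCharacter_smul`).  If `K ≤ G` is a subgroup with COMPACT closure-free carrier
(`IsCompact (K : Set G)`), then `Δ|_K` is a homomorphism `K → ℝ_{>0}` bounded below by `ν(U)∕ν(Ū·K) > 0` (`U ∋ 1` open relatively compact: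
`Δ(k)·ν(Ū K) = ν(Ū K k⁻¹)`-type bound, exactly the argument of ★ `modularCharacter_eq_one_of_compactSpace_quotient`), hence trivial
(★ `monoidHom_eq_one_of_bddBelow`):
* `modularCharacter_eq_one_of_mem_isCompact` — **`Δ(k) = 1` for `k` in a compact subgroup**;
* `map_mul_right_eq_self_of_mem_isCompact` — **`(· k)_* ν = ν`**; `integral_comp_mul_right_of_mem_isCompact` — `∫ f(g k) dν = ∫ f dν` (any `f`);
* `integral_integral_comp_mul_eq_smul` — **AVERAGING**: for a finite measure `ρ` on a measurable space `K₀`, a measurable map `φ : K₀ → G` with values in `K`,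
  and `F` with `(g, κ) ↦ F(g·φ(κ))` integrable for `ν ⊗ ρ`: `∫_G ∫_{K₀} F(g·φ(κ)) dρ(κ) dν(g) = ρ(K₀) • ∫_G F dν` (Fubini + the invariance; `E` complete);
  `integrable_comp_mul_prod` discharges the integrability for `F ∈ C_c(G)`, `φ` continuous, `K₀` compact.
HONEST LABEL: HC_CM is proved only modulo the printed citations until rung 0 closes; generic measure theory, pays nothing by itself.

## References
* [Folland1995] G. B. Folland, *A Course in Abstract Harmonic Analysis* (1995), §2.4 Prop. 2.27, Cor. 2.28 (`Δ` is trivial on compact subgroups).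
* [Helgason2000] S. Helgason, *Groups and Geometric Analysis* (2000), Ch. I §1 No. 1–2.
-/

noncomputable section

open _root_.MeasureTheory _root_.MeasureTheory.Measure _root_.Topology Set Filter Function
open scoped ENNReal NNReal Pointwise

namespace Literature.MeasureTheory.Group

section CompactSubgroup

variable {G : Type*} [Group G] [TopologicalSpace G] [IsTopologicalGroup G] [LocallyCompactSpace G]
  [SecondCountableTopology G] [T2Space G] [MeasurableSpace G] [BorelSpace G]
  (ν : Measure G) [IsHaarMeasure ν]

/-- **THE MODULAR FUNCTION IS TRIVIAL ON A COMPACT SUBGROUP**: `Δ(k) = 1` for `k ∈ K`, `K ≤ G` with compact carrier.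
[cite: Folland1995, §2.4 Prop. 2.27] -/
theorem modularCharacter_eq_one_of_mem_isCompact (K : Subgroup G) (hK : IsCompact (K : Set G)) {k : G} (hk : k ∈ K) :
    modularCharacter k = 1 := by
  let ν₀ : Measure G := MeasureTheory.Measure.haar
  -- an open relatively compact `U ∋ 1`
  obtain ⟨U, hU1, hUo, hUc⟩ : ∃ U : Set G, (1 : G) ∈ U ∧ IsOpen U ∧ IsCompact (closure U) := by
    obtain ⟨C, hC, hC1⟩ := exists_compact_mem_nhds (1 : G)
    exact ⟨interior C, mem_interior_iff_mem_nhds.2 hC1, isOpen_interior,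
      hC.of_isClosed_subset isClosed_closure (closure_minimal interior_subset hC.isClosed)⟩
  have hUpos : 0 < ν₀ U := hUo.measure_pos ν₀ ⟨1, hU1⟩
  have hUtop : ν₀ U ≠ ∞ := (measure_mono subset_closure).trans_lt hUc.measure_lt_top |>.ne
  set S : Set G := closure U * (K : Set G) with hS
  have hSc : IsCompact S := hUc.mul hK
  have hStop : ν₀ S ≠ ∞ := hSc.measure_lt_top.ne
  have hSm : MeasurableSet S := hSc.isClosed.measurableSet
  have hSpos : ν₀ S ≠ 0 := by
    have hsub : U ⊆ S := fun u hu => ⟨u, subset_closure hu, 1, K.one_mem, mul_one u⟩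
    exact (hUpos.trans_le (measure_mono hsub)).ne'
  -- the lower bound `ε = ν₀(U) / ν₀(S)` for `Δ` on `K`
  have hεtop : ν₀ U / ν₀ S ≠ ∞ := ENNReal.div_ne_top hUtop hSpos
  have hεpos : 0 < ν₀ U / ν₀ S := ENNReal.div_pos hUpos.ne' hStop
  set ε : ℝ≥0 := (ν₀ U / ν₀ S).toNNReal with hε
  have hεcoe : (ε : ℝ≥0∞) = ν₀ U / ν₀ S := ENNReal.coe_toNNReal hεtop
  have hε0 : 0 < ε := by rw [← ENNReal.coe_pos, hεcoe]; exact hεpos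
  have hlow : ∀ c ∈ K, ε ≤ modularCharacter c := by
    intro c hc
    have h1 := map_mul_right_eq_modularCharacter_smul ν₀ c
    have h2 : ν₀ U ≤ Measure.map (· * c) ν₀ S := by
      rw [Measure.map_apply (measurable_mul_const c) hSm]
      exact measure_mono fun u hu => ⟨u, subset_closure hu, c, hc, rfl⟩
    rw [h1, Measure.coe_nnreal_smul_apply] at h2
    have h3 : ν₀ U / ν₀ S ≤ modularCharacter c := ENNReal.div_le_of_le_mul h2
    rw [← hεcoe] at h3
    exact_mod_cast h3
  -- `Δ ∘ K.subtype` is a homomorphism bounded below, hence trivial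
  have h := monoidHom_eq_one_of_bddBelow (modularCharacter.comp K.subtype) hε0 (fun x => hlow x x.2) ⟨k, hk⟩
  simpa using h

/-- **A LEFT HAAR MEASURE IS RIGHT-INVARIANT UNDER A COMPACT SUBGROUP**: `(· k)_* ν = ν` for `k ∈ K`. [cite: Folland1995, §2.4 Cor. 2.28] -/
theorem map_mul_right_eq_self_of_mem_isCompact (K : Subgroup G) (hK : IsCompact (K : Set G)) {k : G} (hk : k ∈ K) :
    Measure.map (· * k) ν = ν := by
  rw [map_mul_right_eq_modularCharacter_smul ν k, modularCharacter_eq_one_of_mem_isCompact K hK hk, one_smul]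

/-- `∫ f(g k) dν(g) = ∫ f dν` for `k` in a compact subgroup (any `f`). [cite: Folland1995, §2.4 Cor. 2.28] -/
theorem integral_comp_mul_right_of_mem_isCompact {E : Type*} [NormedAddCommGroup E] [NormedSpace ℝ E]
    (K : Subgroup G) (hK : IsCompact (K : Set G)) {k : G} (hk : k ∈ K) (f : G → E) :
    ∫ g, f (g * k) ∂ν = ∫ g, f g ∂ν := by
  have h := (MeasurableEquiv.mulRight k).measurableEmbedding.integral_map (μ := ν) f
  rw [MeasurableEquiv.coe_mulRight, map_mul_right_eq_self_of_mem_isCompact ν K hK hk] at h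
  exact h.symm

/-- **AVERAGING OVER A COMPACT SUBGROUP**: for a finite measure `ρ` on `K₀`, a measurable `φ : K₀ → G` with values in the compact subgroup `K`, and `F`
with `(g, κ) ↦ F(g·φ(κ))` integrable for `ν ⊗ ρ`: `∫_G ∫_{K₀} F(g·φ(κ)) dρ dν = ρ(K₀) • ∫_G F dν`. [cite: Helgason2000, Ch. I §1 No. 2] -/
theorem integral_integral_comp_mul_eq_smul {E : Type*} [NormedAddCommGroup E] [NormedSpace ℝ E] [CompleteSpace E]
    (K : Subgroup G) (hK : IsCompact (K : Set G)) {K₀ : Type*} [MeasurableSpace K₀] (ρ : Measure K₀) [IsFiniteMeasure ρ]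
    (φ : K₀ → G) (hφK : ∀ κ, φ κ ∈ K) (F : G → E)
    (hF : Integrable (fun p : G × K₀ => F (p.1 * φ p.2)) (ν.prod ρ)) :
    ∫ g, ∫ κ, F (g * φ κ) ∂ρ ∂ν = ρ.real univ • ∫ g, F g ∂ν := by
  rw [integral_integral_swap hF]
  have h : ∀ κ, ∫ g, F (g * φ κ) ∂ν = ∫ g, F g ∂ν := fun κ => integral_comp_mul_right_of_mem_isCompact ν K hK (hφK κ) F
  simp_rw [h]
  rw [integral_const]

/-- The integrability hypothesis of `integral_integral_comp_mul_eq_smul` for `F ∈ C_c(G)`, `φ` continuous, `K₀` compact.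
[cite: Helgason2000, Ch. I §1 No. 2] -/
theorem integrable_comp_mul_prod {E : Type*} [NormedAddCommGroup E] [NormedSpace ℝ E]
    {K₀ : Type*} [TopologicalSpace K₀] [CompactSpace K₀] [T2Space K₀] [MeasurableSpace K₀] [BorelSpace K₀] (ρ : Measure K₀) [IsFiniteMeasure ρ]
    (φ : K₀ → G) (hφ : Continuous φ) (F : G → E) (hF : Continuous F) (hFc : HasCompactSupport F) :
    Integrable (fun p : G × K₀ => F (p.1 * φ p.2)) (ν.prod ρ) := by
  have hc : Continuous fun p : G × K₀ => F (p.1 * φ p.2) := hF.comp (continuous_fst.mul (hφ.comp continuous_snd))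
  -- compact support: `supp ⊆ (tsupport F · (φ K₀)⁻¹) × K₀`
  have hsupp : HasCompactSupport fun p : G × K₀ => F (p.1 * φ p.2) := by
    refine HasCompactSupport.of_support_subset_isCompact ((hFc.mul (isCompact_range hφ).inv).prod isCompact_univ) ?_
    intro p hp
    refine ⟨?_, mem_univ _⟩
    have hmem : p.1 * φ p.2 ∈ tsupport F := subset_tsupport _ hp
    exact ⟨p.1 * φ p.2, hmem, (φ p.2)⁻¹, Set.inv_mem_inv.2 (mem_range_self _), by simp⟩
  exact hc.integrable_of_hasCompactSupport hsupp

end CompactSubgroup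

end Literature.MeasureTheory.Group

end
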